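import Mathlib
import HarnessLib

/-!
# Absorbing the cone tail of the explicit entropy floor: for `m ≥ 2`, `Kc ≤ 1`, `L = s·q` and `c ≤ A/(1024·e·μ·K³·s^ν)`, the tail `L^ν·12μc²·2e^{Kc}(Kc)^{m+1}/(m+1)!` is at most half of the block term `q^ν·A·c⁴/128`

HONEST FRAMING: exact (Metropolis-corrected) sampling algorithms for lattice gauge theory;
figures of merit are autocorrelation/cost numbers at stated couplings and volumes; no
continuum-physics claim.

Venture `LatticeQCDFlow` (cell pub-lqcd), topic `Exactness`; FANOUT row 7 (`s0-cpn-null`).  NEW WORK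
of the cell over Mathlib only (`Real.exp_one_lt_d9`, `Nat.factorial`); nothing is cited as a fact.  The
point: this lineage's closed-form floor for the exact leading-order flow sampler on `(ℤ/L)^ν`
(`Exactness/TorusSublatticeEntropyFloor`) reads `q^ν·A·c⁴/128 − L^ν·12μc²·2e^{Kc}(Kc)^{m+1}/(m+1)!`
(`A = 32κ⁴/((d−1)d²(d+2))`, `μ = κ²(2ν)²/(d−1)`, `K = 3|κ|(2ν)/(d−1)`, `L = s·q`); here the elementary
real inequality that turns it into `q^ν·A·c⁴/256 = L^ν·A·c⁴/(256·s^ν)` under ONE MORE explicit,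
volume-free condition on the flow time: for `m ≥ 2` and `Kc ≤ 1` the tail is at most
`L^ν·4e·μ·K³·c⁵`, and `c ≤ A/(1024·e·μ·K³·s^ν)` makes that at most half of the block term.

## Content

* `pow_mul_div_factorial_le_cube` — `x^{m+1}/(m+1)! ≤ x³/6` for `0 ≤ x ≤ 1`, `m ≥ 2`;
* **`coneTail_le_half_blockTerm`** — the displayed comparison;
* **`half_blockTerm_le_sub_coneTail`** — hence `q^ν·A·c⁴/256 ≤ q^ν·A·c⁴/128 − tail`.

NOT CLAIMED: anything about measures, flows or numbers; optimality of the constants `1024`, `256`.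
-/

namespace Summit.Ventures.LatticeQCDFlow.Exactness

/-- `x^{m+1}/(m+1)! ≤ x³/6` for `0 ≤ x ≤ 1` and `m ≥ 2`. -/
theorem pow_mul_div_factorial_le_cube {x : ℝ} (hx0 : 0 ≤ x) (hx1 : x ≤ 1) {m : ℕ} (hm : 2 ≤ m) :
    x ^ (m + 1) / ((m + 1).factorial : ℝ) ≤ x ^ 3 / 6 := by
  have hfac : (6 : ℝ) ≤ ((m + 1).factorial : ℝ) := by
    have h : (3 : ℕ).factorial ≤ (m + 1).factorial := Nat.factorial_le (by omega)
    exact_mod_cast h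
  have hpow : x ^ (m + 1) ≤ x ^ 3 := pow_le_pow_of_le_one hx0 hx1 (by omega)
  have h3 : 0 ≤ x ^ 3 := by positivity
  calc x ^ (m + 1) / ((m + 1).factorial : ℝ) ≤ x ^ 3 / ((m + 1).factorial : ℝ) :=
        div_le_div_of_nonneg_right hpow (by positivity)
    _ ≤ x ^ 3 / 6 := div_le_div_of_nonneg_left h3 (by norm_num) hfac

/-- **THE CONE TAIL IS AT MOST HALF OF THE BLOCK TERM** once `m ≥ 2`, `0 ≤ Kc ≤ 1` and
`c ≤ A/(1024·e·μ·K³·s^ν)` (`L = s·q`, `0 ≤ μ, K, A`, `0 < s`):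
`L^ν·(12μc²·(2e^{Kc}(Kc)^{m+1}/(m+1)!)) ≤ (q^ν·A·c⁴/128)/2`. -/
theorem coneTail_le_half_blockTerm {ν L s q m : ℕ} (hL : L = s * q) (hs : 0 < s) (hm : 2 ≤ m)
    {μ K A c : ℝ} (hμ : 0 ≤ μ) (hK : 0 ≤ K) (hA : 0 ≤ A) (hc0 : 0 ≤ c) (hKc : K * c ≤ 1)
    (hc : c ≤ A / (1024 * Real.exp 1 * μ * K ^ 3 * (s : ℝ) ^ ν)) :
    (L : ℝ) ^ ν * (12 * μ * c ^ 2 * (2 * Real.exp (K * c) * (K * c) ^ (m + 1) / ((m + 1).factorial : ℝ))) ≤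
      (q : ℝ) ^ ν * A * c ^ 4 / 128 / 2 := by
  have he : Real.exp (K * c) ≤ Real.exp 1 := Real.exp_le_exp.2 hKc
  have he0 : 0 < Real.exp 1 := Real.exp_pos 1
  have hKc0 : 0 ≤ K * c := mul_nonneg hK hc0
  have hsν : (0 : ℝ) < (s : ℝ) ^ ν := by positivity
  have hLq : (L : ℝ) ^ ν = (s : ℝ) ^ ν * (q : ℝ) ^ ν := by
    rw [hL]; push_cast; ring
  -- tail ≤ L^ν · 4e μ K³ c⁵
  have htail : (L : ℝ) ^ ν * (12 * μ * c ^ 2 * (2 * Real.exp (K * c) * (K * c) ^ (m + 1) /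
      ((m + 1).factorial : ℝ))) ≤ (L : ℝ) ^ ν * (4 * Real.exp 1 * μ * K ^ 3 * c ^ 5) := by
    refine mul_le_mul_of_nonneg_left ?_ (by positivity)
    have h1 : 2 * Real.exp (K * c) * (K * c) ^ (m + 1) / ((m + 1).factorial : ℝ) ≤
        2 * Real.exp 1 * ((K * c) ^ 3 / 6) := by
      rw [mul_div_assoc]
      exact mul_le_mul (mul_le_mul_of_nonneg_left he (by norm_num))
        (pow_mul_div_factorial_le_cube hKc0 hKc hm) (by positivity) (by positivity)
    calc 12 * μ * c ^ 2 * (2 * Real.exp (K * c) * (K * c) ^ (m + 1) / ((m + 1).factorial : ℝ))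
        ≤ 12 * μ * c ^ 2 * (2 * Real.exp 1 * ((K * c) ^ 3 / 6)) :=
          mul_le_mul_of_nonneg_left h1 (by positivity)
      _ = 4 * Real.exp 1 * μ * K ^ 3 * c ^ 5 := by ring
  refine htail.trans ?_
  -- L^ν · 4e μ K³ c⁵ ≤ q^ν A c⁴/256  ⟸  s^ν · 1024 e μ K³ · c ≤ A
  rw [hLq]
  by_cases hμK : μ * K ^ 3 = 0
  · have : (s : ℝ) ^ ν * (q : ℝ) ^ ν * (4 * Real.exp 1 * μ * K ^ 3 * c ^ 5) = 0 := by
      have e : 4 * Real.exp 1 * μ * K ^ 3 * c ^ 5 = 4 * Real.exp 1 * (μ * K ^ 3) * c ^ 5 := by ring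
      rw [e, hμK]; ring
    rw [this]; positivity
  · have hpos : 0 < 1024 * Real.exp 1 * μ * K ^ 3 * (s : ℝ) ^ ν := by
      have hμK' : 0 < μ * K ^ 3 := lt_of_le_of_ne (by positivity) (Ne.symm hμK)
      have e : 1024 * Real.exp 1 * μ * K ^ 3 * (s : ℝ) ^ ν = 1024 * Real.exp 1 * (μ * K ^ 3) * (s : ℝ) ^ ν := by
        ring
      rw [e]; positivity
    have hcA : c * (1024 * Real.exp 1 * μ * K ^ 3 * (s : ℝ) ^ ν) ≤ A := (le_div_iff₀ hpos).1 hc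
    have hc4 : 0 ≤ (q : ℝ) ^ ν * c ^ 4 := by positivity
    -- multiply `hcA` by `q^ν c⁴ / 256`
    have key := mul_le_mul_of_nonneg_left hcA hc4
    have e1 : (s : ℝ) ^ ν * (q : ℝ) ^ ν * (4 * Real.exp 1 * μ * K ^ 3 * c ^ 5) =
        (q : ℝ) ^ ν * c ^ 4 * (c * (1024 * Real.exp 1 * μ * K ^ 3 * (s : ℝ) ^ ν)) / 256 := by ring
    have e2 : (q : ℝ) ^ ν * A * c ^ 4 / 128 / 2 = (q : ℝ) ^ ν * c ^ 4 * A / 256 := by ring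
    rw [e1, e2]
    exact div_le_div_of_nonneg_right key (by norm_num)

/-- **Hence the floor is at least half its block term**: under the same conditions,
`q^ν·A·c⁴/256 ≤ q^ν·A·c⁴/128 − L^ν·12μc²·2e^{Kc}(Kc)^{m+1}/(m+1)!`. -/
theorem half_blockTerm_le_sub_coneTail {ν L s q m : ℕ} (hL : L = s * q) (hs : 0 < s) (hm : 2 ≤ m)
    {μ K A c : ℝ} (hμ : 0 ≤ μ) (hK : 0 ≤ K) (hA : 0 ≤ A) (hc0 : 0 ≤ c) (hKc : K * c ≤ 1)
    (hc : c ≤ A / (1024 * Real.exp 1 * μ * K ^ 3 * (s : ℝ) ^ ν)) :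
    (q : ℝ) ^ ν * A * c ^ 4 / 256 ≤
      (q : ℝ) ^ ν * A * c ^ 4 / 128 -
        (L : ℝ) ^ ν * (12 * μ * c ^ 2 * (2 * Real.exp (K * c) * (K * c) ^ (m + 1) / ((m + 1).factorial : ℝ))) := by
  have h := coneTail_le_half_blockTerm (ν := ν) hL hs hm hμ hK hA hc0 hKc hc
  linarith

end Summit.Ventures.LatticeQCDFlow.Exactness
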